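/-
Copyright (c) 2026. All rights reserved.
Released under Apache 2.0 license as described in the file LICENSE.
Authors: abc-iut cell, prover seat abc-iut-E-t42 (gen 7).
-/
import Literature.NumberTheory.NumberFields.QuarticConjugateSums
import Literature.NumberTheory.NumberFields.MinkowskiConjugateSumBound
import Mathlib.Analysis.Real.Pi.Bounds
import HarnessLib

/-!
# Hunter's box for quartic fields: bounds on the characteristic data of a small element

Classical inequalities (nothing disputed; no definition, no `Prop` fact, no instance) turning Minkowski's ℓ¹ bound
`∑ |zᵢ| ≤ B` on the four conjugates of an algebraic integer (`MinkowskiConjugateSumBound`) into a FINITE BOX for its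
integer characteristic data `(s₁, s₂, s₃, s₄)` (`QuarticConjugateSums`), as in Hunter–Pohst enumerations of number fields
of small discriminant:

* §1 four non-negative reals: AM–GM `256·x₀x₁x₂x₃ ≤ S⁴`, Newton–Maclaurin `8e₂ ≤ 3S²`, `16e₃ ≤ S³`, `27abc ≤ (a+b+c)³`,
  and the MODULUS CHAIN `modulus_step` (`∑ xᵢ ≤ B`, `∏ xᵢ = 2`, `xᵢ ≤ c`, `t³c ≤ 54 ⇒ xᵢ ≤ B − t`) with its iterates
  `modulus_le_of_sum_le_553` (`B = 5.53 ⇒ xᵢ ≤ 2.89`) and `modulus_le_of_sum_le_4821` (`B = 4.821 ⇒ xᵢ ≤ 1.651`);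
* §2 four complex numbers: `|e₁| ≤ S`, `|e₂| ≤ 3S²/8`, `|e₃| ≤ S³/16`, `|p_k| ≤ ∑ |zᵢ|^k ≤ 4c^k`;
* §3 the PAIRING bound: `ρ₁²ρ₂² = 2`, `(2ρ₁ + 2ρ₂)⁴ ≤ 934 ⇒ ρ₁^k + ρ₂^k ≤ 2.1^k + 1.2^k`;
* §4 the numerical size of Minkowski's constant in degree `4`: `2·(4/π)^{r₂}·4!·√|d| ≤ 934` (`|d| = 144`), `≤ 540`
  (`|d| = 48`);
* §5 number-field glue: in a quartic field, `|Tr(a^k)| ≤ ∑_σ ‖σ a‖^k`; if the characteristic quartic of `a` is positive on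
  `ℝ` then `K` is totally complex and `|Tr(a^k)| ≤ 2(ρ₁^k + ρ₂^k)` with `ρ₁²ρ₂² = |N a|`, `2ρ₁ + 2ρ₂ = ∑_σ ‖σ a‖`.

[cite: EsmondeMurty1999, Ex. 6.5.12 and Ex. 6.5.21 p. 93] [cite: NeukirchANT1999, Ch. I §2, (2.2)–(2.9)]
-/

namespace Literature.NumberTheory.NumberFields

open NumberField NumberField.InfinitePlace Module Finset

/-! ## §1. Four non-negative reals -/

section Reals

/-- AM–GM for four: `256·x₀x₁x₂x₃ ≤ (x₀+x₁+x₂+x₃)⁴`. [cite: EsmondeMurty1999, Ex. 6.5.12 and Ex. 6.5.21 p. 93] -/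
theorem four_amgm {x₀ x₁ x₂ x₃ : ℝ} (h₀ : 0 ≤ x₀) (h₁ : 0 ≤ x₁) (h₂ : 0 ≤ x₂) (h₃ : 0 ≤ x₃) :
    256 * (x₀ * x₁ * x₂ * x₃) ≤ (x₀ + x₁ + x₂ + x₃) ^ 4 := by
  have hab : 4 * (x₀ * x₁) ≤ (x₀ + x₁) ^ 2 := by nlinarith [sq_nonneg (x₀ - x₁)]
  have hcd : 4 * (x₂ * x₃) ≤ (x₂ + x₃) ^ 2 := by nlinarith [sq_nonneg (x₂ - x₃)]
  have h4 : 4 * ((x₀ + x₁) * (x₂ + x₃)) ≤ ((x₀ + x₁) + (x₂ + x₃)) ^ 2 := by nlinarith [sq_nonneg (x₀ + x₁ - (x₂ + x₃))]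
  have hp : 0 ≤ (x₀ + x₁) * (x₂ + x₃) := by positivity
  calc 256 * (x₀ * x₁ * x₂ * x₃) = 16 * ((4 * (x₀ * x₁)) * (4 * (x₂ * x₃))) := by ring
    _ ≤ 16 * ((x₀ + x₁) ^ 2 * (x₂ + x₃) ^ 2) := by gcongr
    _ = (4 * ((x₀ + x₁) * (x₂ + x₃))) ^ 2 := by ring
    _ ≤ (((x₀ + x₁) + (x₂ + x₃)) ^ 2) ^ 2 := by gcongr
    _ = (x₀ + x₁ + x₂ + x₃) ^ 4 := by ring

/-- Newton's inequality `8e₂ ≤ 3e₁²` for four reals. [cite: EsmondeMurty1999, Ex. 6.5.12 and Ex. 6.5.21 p. 93] -/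
theorem eight_esymm_two_le_three_sq (x₀ x₁ x₂ x₃ : ℝ) :
    8 * (x₀ * x₁ + x₀ * x₂ + x₀ * x₃ + x₁ * x₂ + x₁ * x₃ + x₂ * x₃) ≤ 3 * (x₀ + x₁ + x₂ + x₃) ^ 2 := by
  nlinarith [sq_nonneg (x₀ - x₁), sq_nonneg (x₀ - x₂), sq_nonneg (x₀ - x₃), sq_nonneg (x₁ - x₂), sq_nonneg (x₁ - x₃),
    sq_nonneg (x₂ - x₃)]

/-- Maclaurin's inequality `16e₃ ≤ e₁³` for four NON-NEGATIVE reals (`e₁³ − 16e₃ = (5/3)∑ xᵢ(xⱼ−x_k)² + (1/3)∑ (xᵢ+xⱼ)(xᵢ−xⱼ)²`).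
[cite: EsmondeMurty1999, Ex. 6.5.12 and Ex. 6.5.21 p. 93] -/
theorem sixteen_esymm_three_le_cube {x₀ x₁ x₂ x₃ : ℝ} (h₀ : 0 ≤ x₀) (h₁ : 0 ≤ x₁) (h₂ : 0 ≤ x₂) (h₃ : 0 ≤ x₃) :
    16 * (x₀ * x₁ * x₂ + x₀ * x₁ * x₃ + x₀ * x₂ * x₃ + x₁ * x₂ * x₃) ≤ (x₀ + x₁ + x₂ + x₃) ^ 3 := by
  nlinarith [mul_nonneg h₀ (sq_nonneg (x₁ - x₂)), mul_nonneg h₀ (sq_nonneg (x₁ - x₃)), mul_nonneg h₀ (sq_nonneg (x₂ - x₃)),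
    mul_nonneg h₁ (sq_nonneg (x₀ - x₂)), mul_nonneg h₁ (sq_nonneg (x₀ - x₃)), mul_nonneg h₁ (sq_nonneg (x₂ - x₃)),
    mul_nonneg h₂ (sq_nonneg (x₀ - x₁)), mul_nonneg h₂ (sq_nonneg (x₀ - x₃)), mul_nonneg h₂ (sq_nonneg (x₁ - x₃)),
    mul_nonneg h₃ (sq_nonneg (x₀ - x₁)), mul_nonneg h₃ (sq_nonneg (x₀ - x₂)), mul_nonneg h₃ (sq_nonneg (x₁ - x₂)),
    mul_nonneg (add_nonneg h₀ h₁) (sq_nonneg (x₀ - x₁)), mul_nonneg (add_nonneg h₀ h₂) (sq_nonneg (x₀ - x₂)),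
    mul_nonneg (add_nonneg h₀ h₃) (sq_nonneg (x₀ - x₃)), mul_nonneg (add_nonneg h₁ h₂) (sq_nonneg (x₁ - x₂)),
    mul_nonneg (add_nonneg h₁ h₃) (sq_nonneg (x₁ - x₃)), mul_nonneg (add_nonneg h₂ h₃) (sq_nonneg (x₂ - x₃))]

/-- AM–GM for three: `27abc ≤ (a+b+c)³` for non-negative reals. [cite: EsmondeMurty1999, Ex. 6.5.12 and Ex. 6.5.21 p. 93] -/
theorem three_amgm {a b c : ℝ} (ha : 0 ≤ a) (hb : 0 ≤ b) (hc : 0 ≤ c) :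
    27 * (a * b * c) ≤ (a + b + c) ^ 3 := by
  nlinarith [mul_nonneg ha (sq_nonneg (b - c)), mul_nonneg hb (sq_nonneg (a - c)), mul_nonneg hc (sq_nonneg (a - b)),
    mul_nonneg (add_nonneg (add_nonneg ha hb) hc)
      (add_nonneg (add_nonneg (sq_nonneg (a - b)) (sq_nonneg (b - c))) (sq_nonneg (c - a)))]

/-- **The modulus chain step.**  Four non-negative reals with `∑ xᵢ ≤ B`, `∏ xᵢ = 2`, all `≤ c` (`c > 0`), and a
`t ≥ 0` with `t³·c ≤ 54`: then all `xᵢ ≤ B − t` (the other three have product `2/x₀ ≥ 2/c`, hence sum `≥ t` by AM–GM).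
[cite: EsmondeMurty1999, Ex. 6.5.12 and Ex. 6.5.21 p. 93] -/
theorem modulus_step {x₀ x₁ x₂ x₃ B c t : ℝ} (h₀ : 0 ≤ x₀) (h₁ : 0 ≤ x₁) (h₂ : 0 ≤ x₂) (h₃ : 0 ≤ x₃)
    (hS : x₀ + x₁ + x₂ + x₃ ≤ B) (hP : x₀ * x₁ * x₂ * x₃ = 2)
    (hc₀ : x₀ ≤ c) (hc₁ : x₁ ≤ c) (hc₂ : x₂ ≤ c) (hc₃ : x₃ ≤ c) (ht : 0 ≤ t) (htc : t ^ 3 * c ≤ 54) :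
    x₀ ≤ B - t ∧ x₁ ≤ B - t ∧ x₂ ≤ B - t ∧ x₃ ≤ B - t := by
  -- generic: if y ≤ c, y * q = 2 (q = product of the other three, sum r of the other three), 27 q ≤ r³ then t ≤ r.
  have key : ∀ {y r q : ℝ}, 0 ≤ y → 0 ≤ r → y ≤ c → y * q = 2 → 27 * q ≤ r ^ 3 → t ≤ r := by
    intro y r q hy hr hyc hyq hq
    have hypos : 0 < y := by
      rcases hy.eq_or_lt with h | h
      · rw [← h, zero_mul] at hyq; norm_num at hyq
      · exact h
    have hcpos : 0 < c := lt_of_lt_of_le hypos hyc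
    -- t^3 ≤ 54 / c ≤ 54 / y = 27 q ≤ r^3
    have h1 : t ^ 3 * y ≤ 54 := (mul_le_mul_of_nonneg_left hyc (by positivity)).trans htc
    have h2 : t ^ 3 ≤ 27 * q := by
      have : t ^ 3 * y ≤ 27 * q * y := by nlinarith
      exact le_of_mul_le_mul_right this hypos
    exact le_of_pow_le_pow_left₀ (by norm_num : (3 : ℕ) ≠ 0) hr (h2.trans hq)
  refine ⟨?_, ?_, ?_, ?_⟩
  · have := key h₀ (by positivity : 0 ≤ x₁ + x₂ + x₃) hc₀ (by rw [← hP]; ring) (three_amgm h₁ h₂ h₃); linarith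
  · have := key h₁ (by positivity : 0 ≤ x₀ + x₂ + x₃) hc₁ (by rw [← hP]; ring) (three_amgm h₀ h₂ h₃); linarith
  · have := key h₂ (by positivity : 0 ≤ x₀ + x₁ + x₃) hc₂ (by rw [← hP]; ring) (three_amgm h₀ h₁ h₃); linarith
  · have := key h₃ (by positivity : 0 ≤ x₀ + x₁ + x₂) hc₃ (by rw [← hP]; ring) (three_amgm h₀ h₁ h₂); linarith

/-- **Modulus bound at `B = 5.53`** (the `|d| = 144` box): `∑ xᵢ ≤ 5.53`, `∏ xᵢ = 2 ⇒ xᵢ ≤ 2.89` (four chain steps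
`t = 2.13, 2.51, 2.61, 2.64`). [cite: EsmondeMurty1999, Ex. 6.5.12 and Ex. 6.5.21 p. 93] -/
theorem modulus_le_of_sum_le_553 {x₀ x₁ x₂ x₃ : ℝ} (h₀ : 0 ≤ x₀) (h₁ : 0 ≤ x₁) (h₂ : 0 ≤ x₂) (h₃ : 0 ≤ x₃)
    (hS : x₀ + x₁ + x₂ + x₃ ≤ 553 / 100) (hP : x₀ * x₁ * x₂ * x₃ = 2) :
    x₀ ≤ 289 / 100 ∧ x₁ ≤ 289 / 100 ∧ x₂ ≤ 289 / 100 ∧ x₃ ≤ 289 / 100 := by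
  have hx : ∀ {y p : ℝ}, 0 ≤ y → 0 ≤ p → y + p ≤ 553 / 100 → y ≤ 553 / 100 := fun hy hp h => by linarith
  obtain ⟨a₀, a₁, a₂, a₃⟩ := modulus_step (B := 553 / 100) (c := 553 / 100) (t := 213 / 100) h₀ h₁ h₂ h₃ hS hP
    (by linarith) (by linarith) (by linarith) (by linarith) (by norm_num) (by norm_num)
  obtain ⟨b₀, b₁, b₂, b₃⟩ := modulus_step (t := 251 / 100) h₀ h₁ h₂ h₃ hS hP a₀ a₁ a₂ a₃ (by norm_num) (by norm_num)
  obtain ⟨c₀, c₁, c₂, c₃⟩ := modulus_step (t := 261 / 100) h₀ h₁ h₂ h₃ hS hP b₀ b₁ b₂ b₃ (by norm_num) (by norm_num)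
  obtain ⟨d₀, d₁, d₂, d₃⟩ := modulus_step (t := 264 / 100) h₀ h₁ h₂ h₃ hS hP c₀ c₁ c₂ c₃ (by norm_num) (by norm_num)
  refine ⟨?_, ?_, ?_, ?_⟩ <;> linarith

/-- **Modulus bound at `B = 4.821`** (the `|d| = 48` box): `∑ xᵢ ≤ 4.821`, `∏ xᵢ = 2 ⇒ xᵢ ≤ 1.651` (six chain steps).
[cite: EsmondeMurty1999, Ex. 6.5.12 and Ex. 6.5.21 p. 93] -/
theorem modulus_le_of_sum_le_4821 {x₀ x₁ x₂ x₃ : ℝ} (h₀ : 0 ≤ x₀) (h₁ : 0 ≤ x₁) (h₂ : 0 ≤ x₂) (h₃ : 0 ≤ x₃)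
    (hS : x₀ + x₁ + x₂ + x₃ ≤ 4821 / 1000) (hP : x₀ * x₁ * x₂ * x₃ = 2) :
    x₀ ≤ 1651 / 1000 ∧ x₁ ≤ 1651 / 1000 ∧ x₂ ≤ 1651 / 1000 ∧ x₃ ≤ 1651 / 1000 := by
  obtain ⟨a₀, a₁, a₂, a₃⟩ := modulus_step (B := 4821 / 1000) (c := 4821 / 1000) (t := 223 / 100) h₀ h₁ h₂ h₃ hS hP
    (by linarith) (by linarith) (by linarith) (by linarith) (by norm_num) (by norm_num)
  obtain ⟨b₀, b₁, b₂, b₃⟩ := modulus_step (t := 11 / 4) h₀ h₁ h₂ h₃ hS hP a₀ a₁ a₂ a₃ (by norm_num) (by norm_num)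
  obtain ⟨c₀, c₁, c₂, c₃⟩ := modulus_step (t := 74 / 25) h₀ h₁ h₂ h₃ hS hP b₀ b₁ b₂ b₃ (by norm_num) (by norm_num)
  obtain ⟨d₀, d₁, d₂, d₃⟩ := modulus_step (t := 307 / 100) h₀ h₁ h₂ h₃ hS hP c₀ c₁ c₂ c₃ (by norm_num) (by norm_num)
  obtain ⟨e₀, e₁, e₂, e₃⟩ := modulus_step (t := 313 / 100) h₀ h₁ h₂ h₃ hS hP d₀ d₁ d₂ d₃ (by norm_num) (by norm_num)
  obtain ⟨f₀, f₁, f₂, f₃⟩ := modulus_step (t := 317 / 100) h₀ h₁ h₂ h₃ hS hP e₀ e₁ e₂ e₃ (by norm_num) (by norm_num)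
  refine ⟨?_, ?_, ?_, ?_⟩ <;> linarith

/-- **The pairing bound** (two conjugate pairs of moduli `ρ₁, ρ₂`): `ρ₁²ρ₂² = 2` and `(2ρ₁ + 2ρ₂)⁴ ≤ 934` force
`max ρ ≤ 2.1` (the function `ρ + √2/ρ` is increasing past `2^{1/4}` and `16·(2.1 + 1.414/2.1)⁴ > 934`) and `min ρ ≤ 1.2`,
hence `ρ₁^k + ρ₂^k ≤ 2.1^k + 1.2^k`. [cite: EsmondeMurty1999, Ex. 6.5.12 and Ex. 6.5.21 p. 93] -/
theorem pair_pow_le {ρ₁ ρ₂ : ℝ} (h₁ : 0 ≤ ρ₁) (h₂ : 0 ≤ ρ₂) (hprod : ρ₁ ^ 2 * ρ₂ ^ 2 = 2)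
    (hsum : (2 * ρ₁ + 2 * ρ₂) ^ 4 ≤ 934) (k : ℕ) :
    ρ₁ ^ k + ρ₂ ^ k ≤ (21 / 10 : ℝ) ^ k + (6 / 5 : ℝ) ^ k := by
  -- the product ρ₁ρ₂ = √2 ≥ 1.414
  have hp2 : (ρ₁ * ρ₂) ^ 2 = 2 := by rw [← hprod]; ring
  have hpge : 1414 / 1000 ≤ ρ₁ * ρ₂ := by nlinarith [mul_nonneg h₁ h₂]
  have hple : ρ₁ * ρ₂ ≤ 1415 / 1000 := by nlinarith [mul_nonneg h₁ h₂]
  -- max ≤ 2.1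
  have hmax : ∀ {u v : ℝ}, 0 ≤ u → 0 ≤ v → 1414 / 1000 ≤ u * v → (2 * u + 2 * v) ^ 4 ≤ 934 → u ≤ 21 / 10 := by
    intro u v hu hv huv hs
    by_contra hlt
    push Not at hlt
    have hupos : 0 < u := by linarith
    -- v ≥ 1.414 / u, and u + 1.414/u ≥ 2.1 + 1.414/2.1 since u ≥ 2.1
    have h1 : 21 / 10 * (1414 / 1000) ≤ u * (u * v) := by nlinarith
    have hsum' : (21 / 10 + (1414 / 1000) / (21 / 10) : ℝ) ≤ u + v := by
      have key : 0 ≤ (u - 21 / 10) * (u * (21 / 10) - 1414 / 1000) := mul_nonneg (by linarith) (by nlinarith)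
      rw [show (21 / 10 : ℝ) + 1414 / 1000 / (21 / 10) = (21 / 10 * (21 / 10) + 1414 / 1000) / (21 / 10) by ring,
        div_le_iff₀ (by norm_num : (0:ℝ) < 21 / 10)]
      nlinarith [mul_pos hupos hupos]
    have h3 : (2 * (21 / 10 + (1414 / 1000) / (21 / 10)) : ℝ) ^ 4 ≤ (2 * u + 2 * v) ^ 4 := by
      have : (2 * (21 / 10 + (1414 / 1000) / (21 / 10)) : ℝ) ≤ 2 * u + 2 * v := by linarith
      exact pow_le_pow_left₀ (by norm_num) this 4
    have h4 : (934 : ℝ) < (2 * (21 / 10 + (1414 / 1000) / (21 / 10)) : ℝ) ^ 4 := by norm_num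
    linarith
  have hρ₁ : ρ₁ ≤ 21 / 10 := hmax h₁ h₂ hpge hsum
  have hρ₂ : ρ₂ ≤ 21 / 10 := hmax h₂ h₁ (by rw [mul_comm]; exact hpge) (by rw [add_comm]; exact hsum)
  -- min ≤ 1.2 : min^2 ≤ ρ₁ρ₂ ≤ 1.415 < 1.44
  have hmin : ρ₁ ≤ 6 / 5 ∨ ρ₂ ≤ 6 / 5 := by
    by_contra h
    push Not at h
    have : (6 / 5 : ℝ) * (6 / 5) < ρ₁ * ρ₂ := by nlinarith
    linarith
  rcases hmin with h | h
  · have e1 : ρ₁ ^ k ≤ (6 / 5 : ℝ) ^ k := pow_le_pow_left₀ h₁ h k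
    have e2 : ρ₂ ^ k ≤ (21 / 10 : ℝ) ^ k := pow_le_pow_left₀ h₂ hρ₂ k
    linarith
  · have e1 : ρ₂ ^ k ≤ (6 / 5 : ℝ) ^ k := pow_le_pow_left₀ h₂ h k
    have e2 : ρ₁ ^ k ≤ (21 / 10 : ℝ) ^ k := pow_le_pow_left₀ h₁ hρ₁ k
    linarith

end Reals

/-! ## §2. Four complex numbers: coefficient and power-sum bounds -/

section Cplx

variable (z₀ z₁ z₂ z₃ : ℂ)

/-- `|e₁| ≤ ∑ |zᵢ|`. [cite: EsmondeMurty1999, Ex. 6.5.12 and Ex. 6.5.21 p. 93] -/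
theorem norm_esymm_one_le : ‖z₀ + z₁ + z₂ + z₃‖ ≤ ‖z₀‖ + ‖z₁‖ + ‖z₂‖ + ‖z₃‖ := by
  calc ‖z₀ + z₁ + z₂ + z₃‖ ≤ ‖z₀ + z₁ + z₂‖ + ‖z₃‖ := norm_add_le _ _
    _ ≤ ‖z₀ + z₁‖ + ‖z₂‖ + ‖z₃‖ := by gcongr; exact norm_add_le _ _
    _ ≤ ‖z₀‖ + ‖z₁‖ + ‖z₂‖ + ‖z₃‖ := by gcongr; exact norm_add_le _ _

/-- `|e₂| ≤ e₂(|z|) ≤ 3(∑|zᵢ|)²/8`. [cite: EsmondeMurty1999, Ex. 6.5.12 and Ex. 6.5.21 p. 93] -/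
theorem norm_esymm_two_le :
    8 * ‖z₀ * z₁ + z₀ * z₂ + z₀ * z₃ + z₁ * z₂ + z₁ * z₃ + z₂ * z₃‖ ≤ 3 * (‖z₀‖ + ‖z₁‖ + ‖z₂‖ + ‖z₃‖) ^ 2 := by
  have h : ‖z₀ * z₁ + z₀ * z₂ + z₀ * z₃ + z₁ * z₂ + z₁ * z₃ + z₂ * z₃‖
      ≤ ‖z₀‖ * ‖z₁‖ + ‖z₀‖ * ‖z₂‖ + ‖z₀‖ * ‖z₃‖ + ‖z₁‖ * ‖z₂‖ + ‖z₁‖ * ‖z₃‖ + ‖z₂‖ * ‖z₃‖ := by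
    simp only [← norm_mul]
    exact norm_add_le_of_le (norm_add_le_of_le (norm_add_le_of_le (norm_add_le_of_le (norm_add_le _ _) le_rfl)
      le_rfl) le_rfl) le_rfl
  have h2 := eight_esymm_two_le_three_sq ‖z₀‖ ‖z₁‖ ‖z₂‖ ‖z₃‖
  linarith

/-- `|e₃| ≤ e₃(|z|) ≤ (∑|zᵢ|)³/16`. [cite: EsmondeMurty1999, Ex. 6.5.12 and Ex. 6.5.21 p. 93] -/
theorem norm_esymm_three_le :
    16 * ‖z₀ * z₁ * z₂ + z₀ * z₁ * z₃ + z₀ * z₂ * z₃ + z₁ * z₂ * z₃‖ ≤ (‖z₀‖ + ‖z₁‖ + ‖z₂‖ + ‖z₃‖) ^ 3 := by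
  have h : ‖z₀ * z₁ * z₂ + z₀ * z₁ * z₃ + z₀ * z₂ * z₃ + z₁ * z₂ * z₃‖
      ≤ ‖z₀‖ * ‖z₁‖ * ‖z₂‖ + ‖z₀‖ * ‖z₁‖ * ‖z₃‖ + ‖z₀‖ * ‖z₂‖ * ‖z₃‖ + ‖z₁‖ * ‖z₂‖ * ‖z₃‖ := by
    simp only [← norm_mul]
    exact norm_add_le_of_le (norm_add_le_of_le (norm_add_le _ _) le_rfl) le_rfl
  have h2 := sixteen_esymm_three_le_cube (norm_nonneg z₀) (norm_nonneg z₁) (norm_nonneg z₂) (norm_nonneg z₃)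
  linarith

/-- `|∑ zᵢ^k| ≤ ∑ |zᵢ|^k ≤ 4c^k` when all `|zᵢ| ≤ c`. [cite: EsmondeMurty1999, Ex. 6.5.12 and Ex. 6.5.21 p. 93] -/
theorem norm_powersum_le {c : ℝ} (h₀ : ‖z₀‖ ≤ c) (h₁ : ‖z₁‖ ≤ c) (h₂ : ‖z₂‖ ≤ c) (h₃ : ‖z₃‖ ≤ c) (k : ℕ) :
    ‖z₀ ^ k + z₁ ^ k + z₂ ^ k + z₃ ^ k‖ ≤ 4 * c ^ k := by
  have e₀ : ‖z₀ ^ k‖ ≤ c ^ k := by rw [norm_pow]; exact pow_le_pow_left₀ (norm_nonneg _) h₀ k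
  have e₁ : ‖z₁ ^ k‖ ≤ c ^ k := by rw [norm_pow]; exact pow_le_pow_left₀ (norm_nonneg _) h₁ k
  have e₂ : ‖z₂ ^ k‖ ≤ c ^ k := by rw [norm_pow]; exact pow_le_pow_left₀ (norm_nonneg _) h₂ k
  have e₃ : ‖z₃ ^ k‖ ≤ c ^ k := by rw [norm_pow]; exact pow_le_pow_left₀ (norm_nonneg _) h₃ k
  calc ‖z₀ ^ k + z₁ ^ k + z₂ ^ k + z₃ ^ k‖ ≤ ‖z₀ ^ k‖ + ‖z₁ ^ k‖ + ‖z₂ ^ k‖ + ‖z₃ ^ k‖ := norm_esymm_one_le _ _ _ _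
    _ ≤ 4 * c ^ k := by linarith

end Cplx

/-! ## §4. The size of Minkowski's ℓ¹ constant in degree four -/

section Numerics

open Real

/-- `(4/π)^r ≤ 1.6212` for `r ≤ 2` (`π > 3.1415`). [cite: EsmondeMurty1999, Ex. 6.5.12 and Ex. 6.5.21 p. 93] -/
theorem four_div_pi_pow_le {r : ℕ} (hr : r ≤ 2) : (4 / π : ℝ) ^ r ≤ 16212 / 10000 := by
  have h1 : (1 : ℝ) ≤ 4 / π := by
    rw [le_div_iff₀ Real.pi_pos, one_mul]; exact Real.pi_lt_four.le
  have h2 : (4 / π : ℝ) ^ r ≤ (4 / π) ^ 2 := pow_le_pow_right₀ h1 hr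
  have h3 : (4 / π : ℝ) < 4 / 3.141592 := by
    gcongr
    exact Real.pi_gt_d6
  have h0 : (0 : ℝ) ≤ 4 / π := le_trans (by norm_num) h1
  have h4 : (4 / π : ℝ) ^ 2 ≤ (4 / 3.141592) ^ 2 := pow_le_pow_left₀ h0 h3.le 2
  have h5 : ((4 : ℝ) / 3.141592) ^ 2 ≤ 16212 / 10000 := by norm_num
  linarith

/-- **`2·(4/π)^r·4!·√144 ≤ 934`** for `r ≤ 2`. [cite: EsmondeMurty1999, Ex. 6.5.12 and Ex. 6.5.21 p. 93] -/
theorem minkowski_const_144_le {r : ℕ} (hr : r ≤ 2) :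
    (2 : ℝ) * (4 / π) ^ r * (Nat.factorial 4 : ℕ) * Real.sqrt 144 ≤ 934 := by
  have hs : Real.sqrt (144 : ℝ) = 12 := by
    rw [show (144 : ℝ) = 12 ^ 2 by norm_num]
    exact Real.sqrt_sq (by norm_num)
  rw [hs]
  have := four_div_pi_pow_le hr
  have h0 : (0 : ℝ) ≤ (4 / π) ^ r := by positivity
  norm_num [Nat.factorial]
  nlinarith

/-- **`2·(4/π)^r·4!·√48 ≤ 540`** for `r ≤ 2` (`√48 ≤ 6.9283`). [cite: EsmondeMurty1999, Ex. 6.5.12 and Ex. 6.5.21 p. 93] -/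
theorem minkowski_const_48_le {r : ℕ} (hr : r ≤ 2) :
    (2 : ℝ) * (4 / π) ^ r * (Nat.factorial 4 : ℕ) * Real.sqrt 48 ≤ 540 := by
  have hs : Real.sqrt (48 : ℝ) ≤ 69283 / 10000 := by
    rw [Real.sqrt_le_left (by norm_num)]
    norm_num
  have hs0 : 0 ≤ Real.sqrt (48 : ℝ) := Real.sqrt_nonneg _
  have := four_div_pi_pow_le hr
  have h0 : (0 : ℝ) ≤ (4 / π) ^ r := by positivity
  norm_num [Nat.factorial] at hs ⊢
  nlinarith [mul_nonneg h0 hs0]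

/-- The same two bounds with `|d|` in place of `d` (both signs). [cite: EsmondeMurty1999, Ex. 6.5.12 and Ex. 6.5.21 p. 93] -/
theorem minkowski_const_le_of_natAbs {r : ℕ} (hr : r ≤ 2) {D : ℤ} :
    (D.natAbs = 144 → (2 : ℝ) * (4 / π) ^ r * (Nat.factorial 4 : ℕ) * Real.sqrt |(D : ℝ)| ≤ 934) ∧
    (D.natAbs = 48 → (2 : ℝ) * (4 / π) ^ r * (Nat.factorial 4 : ℕ) * Real.sqrt |(D : ℝ)| ≤ 540) := by
  have habs : ∀ n : ℕ, D.natAbs = n → |(D : ℝ)| = (n : ℝ) := by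
    intro n hn
    rw [← Int.cast_abs, Int.abs_eq_natAbs, hn]
    simp
  constructor
  · intro h; rw [habs 144 h]; exact_mod_cast minkowski_const_144_le hr
  · intro h; rw [habs 48 h]; exact_mod_cast minkowski_const_48_le hr

end Numerics

/-! ## §5. Number-field glue -/

section Glue

variable {K : Type*} [Field K] [NumberField K] (e : (K →+* ℂ) ≃ Fin 4)

/-- `|Tr(a^k)| ≤ ∑ᵢ ‖zᵢ‖^k`-type bound: if all conjugates have modulus `≤ c` then `|Tr(a^k)| ≤ 4c^k`.
[cite: NeukirchANT1999, Ch. I §2, (2.2)–(2.9)] -/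
theorem abs_trace_pow_le_of_conj_le (x : 𝓞 K) {c : ℝ} (h₀ : ‖(e.symm 0) (x : K)‖ ≤ c) (h₁ : ‖(e.symm 1) (x : K)‖ ≤ c)
    (h₂ : ‖(e.symm 2) (x : K)‖ ≤ c) (h₃ : ‖(e.symm 3) (x : K)‖ ≤ c) (k : ℕ) :
    (|(Algebra.trace ℤ (𝓞 K) (x ^ k) : ℤ)| : ℝ) ≤ 4 * c ^ k := by
  have h := norm_powersum_le _ _ _ _ h₀ h₁ h₂ h₃ k
  rw [← trace_int_pow_cast_eq_sum e, Complex.norm_intCast] at h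
  exact h

/-- The number of complex places of a quartic field is `≤ 2`. [cite: NeukirchANT1999, Ch. I §2, (2.2)–(2.9)] -/
theorem nrComplexPlaces_le_two (h4 : finrank ℚ K = 4) : nrComplexPlaces K ≤ 2 := by
  have := card_add_two_mul_card_eq_rank K
  omega

omit [NumberField K] in
/-- **A quartic positive on `ℝ` makes `K` totally complex**: if the characteristic quartic of `x` (with the conjugate
data `s₁,…,s₄`) has no real root, every infinite place of `K` is complex. [cite: NeukirchANT1999, Ch. I §2, (2.2)–(2.9)] -/
theorem isComplex_of_forall_pos {x : 𝓞 K} {s₁ s₂ s₃ s₄ : ℤ}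
    (h₁ : (s₁ : ℂ) = (e.symm 0) x + (e.symm 1) x + (e.symm 2) x + (e.symm 3) x)
    (h₂ : (s₂ : ℂ) = (e.symm 0) x * (e.symm 1) x + (e.symm 0) x * (e.symm 2) x + (e.symm 0) x * (e.symm 3) x
        + (e.symm 1) x * (e.symm 2) x + (e.symm 1) x * (e.symm 3) x + (e.symm 2) x * (e.symm 3) x)
    (h₃ : (s₃ : ℂ) = (e.symm 0) x * (e.symm 1) x * (e.symm 2) x + (e.symm 0) x * (e.symm 1) x * (e.symm 3) x
        + (e.symm 0) x * (e.symm 2) x * (e.symm 3) x + (e.symm 1) x * (e.symm 2) x * (e.symm 3) x)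
    (h₄ : (s₄ : ℂ) = (e.symm 0) x * (e.symm 1) x * (e.symm 2) x * (e.symm 3) x)
    (hpos : ∀ t : ℝ, 0 < t ^ 4 - s₁ * t ^ 3 + s₂ * t ^ 2 - s₃ * t + s₄) (w : InfinitePlace K) : w.IsComplex := by
  rw [← not_isReal_iff_isComplex]
  intro hw
  have hφ : ComplexEmbedding.IsReal w.embedding := isReal_iff.mp hw
  obtain ⟨i, hi⟩ : ∃ i : Fin 4, w.embedding = e.symm i := ⟨e w.embedding, by simp⟩
  have hroot := conj_isRoot h₁ h₂ h₃ h₄ i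
  rw [← hi] at hroot
  have hre : (w.embedding (x : K)) = ((w.embedding (x : K)).re : ℂ) := by
    have h := (ComplexEmbedding.IsReal.coe_embedding_apply hφ (x : K)).symm
    rw [h, Complex.ofReal_re]
  rw [hre] at hroot
  have := hpos (w.embedding (x : K)).re
  have h0 : (((w.embedding (x : K)).re ^ 4 - s₁ * (w.embedding (x : K)).re ^ 3 + s₂ * (w.embedding (x : K)).re ^ 2
      - s₃ * (w.embedding (x : K)).re + s₄ : ℝ) : ℂ) = 0 := by
    push_cast
    exact hroot
  have : ((w.embedding (x : K)).re ^ 4 - s₁ * (w.embedding (x : K)).re ^ 3 + s₂ * (w.embedding (x : K)).re ^ 2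
      - s₃ * (w.embedding (x : K)).re + s₄ : ℝ) = 0 := by exact_mod_cast h0
  linarith

/-- **The pairing form of the conjugate sums in a totally complex quartic field**: there are two infinite places
`w₁ ≠ w₂`, both of multiplicity `2`, with `∑_σ ‖σ x‖ = 2 w₁(x) + 2 w₂(x)`, `w₁(x)² w₂(x)² = |N x|` and
`|Tr(x^k)| ≤ 2 (w₁(x)^k + w₂(x)^k)`. [cite: NeukirchANT1999, Ch. I §2, (2.2)–(2.9)] -/
theorem exists_pair_of_isComplex (h4 : finrank ℚ K = 4) (hc : ∀ w : InfinitePlace K, w.IsComplex) (x : 𝓞 K) :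
    ∃ w₁ w₂ : InfinitePlace K, w₁ ≠ w₂ ∧
      (∑ σ : K →+* ℂ, ‖σ (x : K)‖) = 2 * w₁ (x : K) + 2 * w₂ (x : K) ∧
      w₁ (x : K) ^ 2 * w₂ (x : K) ^ 2 = |(Algebra.norm ℤ x : ℤ)| ∧
      ∀ k : ℕ, (|(Algebra.trace ℤ (𝓞 K) (x ^ k) : ℤ)| : ℝ) ≤ 2 * (w₁ (x : K) ^ k + w₂ (x : K) ^ k) := by
  classical
  have hmult : ∀ w : InfinitePlace K, mult w = 2 := fun w => by
    rw [mult, if_neg (not_isReal_iff_isComplex.mpr (hc w))]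
  have hr0 : nrRealPlaces K = 0 := by
    rw [nrRealPlaces, Fintype.card_eq_zero_iff]
    exact ⟨fun ⟨w, hw⟩ => (not_isReal_iff_isComplex.mpr (hc w)) hw⟩
  have hcard : Fintype.card (InfinitePlace K) = 2 := by
    have h1 := card_add_two_mul_card_eq_rank K
    have h2 := card_eq_nrRealPlaces_add_nrComplexPlaces K
    rw [hr0] at h1 h2
    omega
  have hcard' : (Finset.univ : Finset (InfinitePlace K)).card = 2 := by rw [Finset.card_univ, hcard]
  obtain ⟨w₁, w₂, hne, huniv⟩ := Finset.card_eq_two.mp hcard'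
  have hsum : ∀ f : InfinitePlace K → ℝ, ∑ w, f w = f w₁ + f w₂ := fun f => by
    rw [← Finset.sum_pair hne, ← huniv]
  have hprod : ∀ f : InfinitePlace K → ℝ, ∏ w, f w = f w₁ * f w₂ := fun f => by
    rw [← Finset.prod_pair hne, ← huniv]
  refine ⟨w₁, w₂, hne, ?_, ?_, ?_⟩
  · rw [sum_norm_embeddings_eq_sum_mult, hsum]
    simp [hmult]
  · have h := prod_eq_abs_norm (x : K)
    rw [hprod] at h
    simp only [hmult] at h
    rw [h, ← Algebra.coe_norm_int]
    push_cast
    rfl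
  · intro k
    have h1 : (|(Algebra.trace ℤ (𝓞 K) (x ^ k) : ℤ)| : ℝ) ≤ ∑ σ : K →+* ℂ, ‖σ (x : K)‖ ^ k := by
      have e4 : ((Algebra.trace ℤ (𝓞 K) (x ^ k) : ℤ) : ℂ) = ∑ σ : K →+* ℂ, σ (x : K) ^ k := by
        obtain ⟨e⟩ : Nonempty ((K →+* ℂ) ≃ Fin 4) :=
          ⟨Fintype.equivFinOfCardEq (by rw [NumberField.Embeddings.card, h4])⟩
        rw [trace_int_pow_cast_eq_sum e, sum_embeddings_eq_sum_fin e (fun σ : K →+* ℂ => σ (x : K) ^ k)]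
      have : ‖((Algebra.trace ℤ (𝓞 K) (x ^ k) : ℤ) : ℂ)‖ ≤ ∑ σ : K →+* ℂ, ‖σ (x : K) ^ k‖ := by
        rw [e4]; exact norm_sum_le _ _
      simpa [Complex.norm_intCast, norm_pow] using this
    rw [sum_norm_embeddings_pow_eq_sum_mult, hsum] at h1
    simp only [hmult, Nat.cast_ofNat] at h1
    linarith

end Glue

end Literature.NumberTheory.NumberFields
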